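import Literature.Geometry.Kaehler.ComplexTorusAndreFormDecomposable
import HarnessLib

/-!
# André's Hodge involution on the Lefschetz string of `1` and on decomposable classes: `*_H(η^{∧j}) = (j!/(g−j)!) η^{∧(g−j)}`, `*_H 1 = η^{∧g}/g!`,
# `*_H(ξ₀ ∧ ⋯ ∧ ξ_{k−1} ∧ 1) = ((−1)^{k(k−1)/2}/g!) · ξ₀♯ ⌟ ⋯ ⌟ ξ_{k−1}♯ ⌟ η^{∧g}` — Brylinski's symplectic star `⋆_ω` up to `(−1)^{k(k−1)/2}`

Layer `Literature/Geometry/Kaehler`, namespace `Literature.Geometry.Kaehler.ComplexTorus`; lane `lit-hodgefound` (Track 2 foundations library),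
prover seat `lit-hodgefound-p35` (generation 53, row g53-#10; sequel of g53-#6 `ComplexTorusAndreFormDecomposable` (the decomposable class
`ξ₀ ∧ ⋯ ∧ ξ_{k−1} ∧ 1` is homogeneous of degree `k`) and of p09's g51-#2 `ComplexTorusLefschetzWeylOperatorCAR` (`w(ξ₁ ∧ ⋯ ∧ ξₖ ∧ c) = ((−1)^g/g!) ξ₁♯ ⌟ ⋯ ⌟ ξₖ♯ ⌟ L_η^g c`)).
THEOREMS ONLY: no definition, no named fact, no instance, no notation; D-0026 net debt `0`.

THE POINT. p09 computed the WEYL OPERATOR on decomposable classes and identified it with Brylinski's symplectic star up to `(−1)^g` ("quoted as the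
interpretation, not restated"). André's `*_H` is `(−1)^{g + n(n−1)/2} w` on `Hⁿ` (row g49-#3 `andreHodgeInvolution_of`); this file spells out the resulting CLOSED
FORMULAS for André's operator itself: on the Lefschetz string of the unit (André's printed `*_H(Lʲ x_i) = (−1)^{i(i+1)/2} (j!/(d−i−j)!) L^{d−i−j} x_i` with `x_i = 1`,
`i = 0`, `d = g` — NO sign), and on decomposable classes (the contraction of the Liouville form `η^{∧g}/g!` by the `η`-dual multivector, with the sign `(−1)^{k(k−1)/2}`):
André's `*_H` is Brylinski's `⋆_ω` composed with `(−1)^{k(k−1)/2}` on `Hᵏ` — cf. row g53-#7, where `K_H = B_e(·, *_H ·)` came out as the Gram determinant of `η⁻¹` times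
`sign_X(e) ∫_X η^{∧g}/g!`, i.e. Brylinski's "`α ∧ ⋆_ω β = (ω⁻¹)ᵏ(α, β) ωⁿ/n!`" with the `(−1)^{k(k−1)/2}` absorbed by the graded symmetry of `B_e`.

## What is proved (`*_H = andreHodgeInvolution … (finrank ℂ E)`, `L = lefschetzG η`, `g = finrank ℂ E`)

* §1 **`andreHodgeInvolution_lefschetzG_pow_one`** (`*_H(Lʲ 1) = (j!/(g−j)!) · L^{g−j} 1`, `j ≤ g`), **`andreHodgeInvolution_one`** (`*_H 1 = (g!)⁻¹ · L^g 1 = η^{∧g}/g!`),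
  `andreHodgeInvolution_lefschetzG_pow_finrank_one` (`*_H(L^g 1) = g! · 1`).
* §2 **`andreHodgeInvolution_foldr_wedgeOneG_finRange_one`**
  (`*_H(ξ₀ ∧ ⋯ ∧ ξ_{k−1} ∧ 1) = ((−1)^{k(k−1)/2} (g!)⁻¹) · ξ₀♯ ⌟ (ξ₁♯ ⌟ ⋯ (ξ_{k−1}♯ ⌟ L^g 1))`).

## Sources, VERBATIM

* Y. André, *Pour une théorie inconditionnelle des motifs*, Publ. Math. IHÉS **83** (1996) [Andre1996Motifs], §1.1 (p. 10): "`*_H x = Σ (−1)^{(j−2k)(j−2k+1)/2}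
  (k!/(d−j+k)!) L^{d−j+k} x_{j−2k}`" (involutions de Lefschetz et de Hodge); §1.2 (p. 11).
* D. Angella, *Cohomological Aspects in Complex Non-Kähler Geometry* (LNM 2095, 2014) [Angella2014NonKaehler], §1.2 (p. 32 L20–L25): "`⋆_ω` […] introduced by
  J.-L. Brylinski, [Bry88, Sect. 2], is defined requiring that […] `α ∧ ⋆_ω β = (ω⁻¹)ᵏ(α, β) ωⁿ/n!`".
* N. Bourbaki, *Lie Groups and Lie Algebras, Ch. 7–9* [Bourbaki2008LieGroups79], Ch. VIII §1 no. 5 (p. 96, formula (4)).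
* D. Huybrechts, *Complex Geometry* (2005) [Huybrechts2005], §1.2 Prop. 1.2.30, Cor. 1.2.27.

## Scope

`η` non-degenerate only; the operator identity "`*_H = (−1)^{k(k−1)/2} ⋆_ω` on `Hᵏ`" is given on the spanning decomposable classes (no `⋆_ω` is defined).
-/

noncomputable section

-- `Module ℂ` / `SMulZeroClass ℂ` synthesis on `E [⋀^Fin k]→L[ℝ] ℂ` (as in `ComplexTorusLefschetzDecomposition`)
set_option maxSynthPendingDepth 3

namespace Literature.Geometry.Kaehler

namespace ComplexTorus

open Module Function Finset
open Literature.LinearAlgebra.Alternating Literature.Algebra.Lie Literature.Analysis.Complex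

universe uE

variable {E : Type uE} [NormedAddCommGroup E] [NormedSpace ℂ E] [FiniteDimensional ℂ E] {η : E [⋀^Fin 2]→L[ℝ] ℝ}
  [Nontrivial E] (hη : ∀ v : E, v ≠ 0 → ∃ w : E, η ![v, w] ≠ 0)

/-! ## §1 `*_H` on the Lefschetz string `1, η, η², …, η^g` of the unit -/

section String

/-- **`*_H(Lʲ 1) = (j!/(g−j)!) · L^{g−j} 1`** for `j ≤ g` (`L = η ∧ ·`, `1 ∈ H⁰` primitive of lowest weight `−g`): André's printed
`*_H(Lʲ x_i) = (−1)^{i(i+1)/2} (j!/(d−i−j)!) L^{d−i−j} x_i` with `x_i = 1`, `i = 0`, `d = g` — no sign. [cite: Andre1996Motifs, §1.1 (p. 10)] -/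
theorem andreHodgeInvolution_lefschetzG_pow_one {j : ℕ} (hj : j ≤ finrank ℂ E) :
    (hasLefschetzProperty_lefschetzG hη).andreHodgeInvolution isZGrading_countingG (finrank ℂ E) ((lefschetzG η ^ j) (1 : GForm E ℂ)) =
      (((j.factorial : ℕ) : ℂ) * (((finrank ℂ E - j).factorial : ℕ) : ℂ)⁻¹) • (lefschetzG η ^ (finrank ℂ E - j)) (1 : GForm E ℂ) := by
  have h1 : (1 : GForm E ℂ) ∈ HasLefschetzProperty.primitiveSpace (countingG E) (lefschetzG η) (finrank ℂ E) := by
    rw [GForm.one_def]; exact of_zero_mem_primitiveSpace η _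
  rw [(hasLefschetzProperty_lefschetzG hη).andreHodgeInvolution_apply_pow_primitive isZGrading_countingG (finrank ℂ E) h1 hj, Nat.sub_self, zero_mul,
    Nat.zero_div, pow_zero, one_mul]

/-- **`*_H 1 = (g!)⁻¹ · L^g 1 = η^{∧g}/g!`** — Brylinski's `⋆_ω 1 = ωⁿ/n!`, exactly (no sign). [cite: Andre1996Motifs, §1.1 (p. 10)] [cite: Angella2014NonKaehler, §1.2 (p. 32 L20–L25)] -/
theorem andreHodgeInvolution_one :
    (hasLefschetzProperty_lefschetzG hη).andreHodgeInvolution isZGrading_countingG (finrank ℂ E) (1 : GForm E ℂ) =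
      (((finrank ℂ E).factorial : ℕ) : ℂ)⁻¹ • (lefschetzG η ^ finrank ℂ E) (1 : GForm E ℂ) := by
  have h := andreHodgeInvolution_lefschetzG_pow_one hη (Nat.zero_le (finrank ℂ E))
  rwa [pow_zero, Module.End.one_apply, Nat.factorial_zero, Nat.cast_one, one_mul, Nat.sub_zero] at h

/-- **`*_H(L^g 1) = g! · 1`** (`*_H(η^{∧g}) = g!`). [cite: Andre1996Motifs, §1.1 (p. 10)] -/
theorem andreHodgeInvolution_lefschetzG_pow_finrank_one :
    (hasLefschetzProperty_lefschetzG hη).andreHodgeInvolution isZGrading_countingG (finrank ℂ E) ((lefschetzG η ^ finrank ℂ E) (1 : GForm E ℂ)) =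
      (((finrank ℂ E).factorial : ℕ) : ℂ) • (1 : GForm E ℂ) := by
  rw [andreHodgeInvolution_lefschetzG_pow_one hη le_rfl, Nat.sub_self, Nat.factorial_zero, Nat.cast_one, inv_one, mul_one, pow_zero, Module.End.one_apply]

end String

/-! ## §2 `*_H` on decomposable classes: Brylinski's star up to `(−1)^{k(k−1)/2}` -/

section Decomposable

omit [Nontrivial E] in
/-- `k(k−1)/2 + g + g` has the parity of `k(k−1)/2` (sign bookkeeping). [folklore] -/
private theorem neg_one_pow_add_mul₆₅ (g a : ℕ) : (-1 : ℂ) ^ (g + a) * (-1) ^ g = (-1) ^ a := by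
  rw [← pow_add, show g + a + g = a + 2 * g by ring, pow_add, pow_mul, neg_one_sq, one_pow, mul_one]

/-- **`*_H(ξ₀ ∧ ⋯ ∧ ξ_{k−1} ∧ 1) = ((−1)^{k(k−1)/2} (g!)⁻¹) · ξ₀♯ ⌟ (ξ₁♯ ⌟ ⋯ (ξ_{k−1}♯ ⌟ η^{∧g}))`** (`η(w, ξᵢ♯) = ξᵢ(w)`; `η^{∧g} = L^g 1`): André's Hodge involution of a
decomposable class is the contraction of the Liouville form `η^{∧g}/g!` by the dual multivector, times `(−1)^{k(k−1)/2}` — i.e. `*_H|_{Hᵏ} = (−1)^{k(k−1)/2} ⋆_ω`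
for Brylinski's symplectic star (`*_H = (−1)^{g+k(k−1)/2} w` on `Hᵏ` and p09's `w(ξ₁ ∧ ⋯ ∧ ξₖ ∧ c) = ((−1)^g/g!) ξ₁♯ ⌟ ⋯ ⌟ ξₖ♯ ⌟ L^g c`).
[cite: Andre1996Motifs, §1.1 (p. 10), §1.2 (p. 11)] [cite: Angella2014NonKaehler, §1.2 (p. 32 L20–L25)] [cite: Bourbaki2008LieGroups79, Ch. VIII §1 no. 5 (p. 96)] -/
theorem andreHodgeInvolution_foldr_wedgeOneG_finRange_one {k : ℕ} {ξ : Fin k → E →L[ℝ] ℝ} {v : Fin k → E} (hv : ∀ a w, η ![w, v a] = ξ a w) :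
    (hasLefschetzProperty_lefschetzG hη).andreHodgeInvolution isZGrading_countingG (finrank ℂ E)
        ((List.finRange k).foldr (fun a z ↦ GForm.wedgeOneG (ξ a) z) (1 : GForm E ℂ)) =
      ((-1 : ℂ) ^ (k * (k - 1) / 2) * (((finrank ℂ E).factorial : ℕ) : ℂ)⁻¹) •
        (List.finRange k).foldr (fun a z ↦ GForm.curryLeftG (v a) z) ((lefschetzG η ^ finrank ℂ E) (1 : GForm E ℂ)) := by
  rw [foldr_wedgeOneG_finRange_one_eq_of ξ, andreHodgeInvolution_of hη rfl k, ← foldr_wedgeOneG_finRange_one_eq_of ξ, GForm.one_def,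
    weylOperator_foldr_wedgeOneG_of_zero hη hv, smul_smul, ← GForm.one_def, ← mul_assoc, neg_one_pow_add_mul₆₅]

end Decomposable

end ComplexTorus

end Literature.Geometry.Kaehler
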